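import Summits.Ventures.YMGap.Conjectures.ChiralClockComparisonProof
import HarnessLib

/-!
# Venture YMGap — Conjectures/ChiralClockComparisonMultigraph.lean: the chiral `ℤ₃` clock comparison for a FINITE FAMILY OF PAIR TERMS on any
# finite vertex type (multigraph form) — the interface a lattice-gauge layer translation needs

HONEST FRAMING (venture `Summits/Ventures/YMGap`, cell `pub-ymgap`, track Y2 ROBUST-BALL, seat ds-4 g15).  Two definitions (`multiClockWeight`,
`multiClockCorr`) and theorems; finite sums only.  `Conjectures/ChiralClockComparisonProof.lean` proves the typed conjecture (C) for coupling
MATRICES on `Fin n` (one term per ordered pair).  A layer of a lattice gauge configuration produces instead a finite FAMILY of pair terms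
`j ↦ a_j cos(2π(k_{u_j} − k_{v_j})/3 + φ_j)` on a finite vertex type `V` (several plaquette / boundary terms may join the same pair of free links,
frozen links enter as phases), and the comparison partner one wants is the ferromagnet with ALL phases `0`, i.e. coupling `∑_j a_j` per pair —
no Griffiths-II monotonicity step.  The Messager–Miracle-Solé–Pfister duplication (`2` is a unit of `ℤ₃`; see the proof file) is blind to this
bookkeeping, so the same argument gives, for every finite `V`, `J`, `u v : J → V`, `a ≥ 0`, `φ`, `b, t` and real `ψ`:
`Re(e^{−iψ} ⟨ω^{k_b−k_t}⟩_{a,φ}) ≤ Re ⟨ω^{k_b−k_t}⟩_{a,0}` (`re_exp_mul_multiClockCorr_le`), hence **`multiClockComparison`**: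
`‖⟨ω^{k_b−k_t}⟩_{a,φ}‖ ≤ Re ⟨ω^{k_b−k_t}⟩_{a,0}`, and Griffiths' first inequality `0 ≤ Re ⟨ω^{k_b−k_t}⟩_{a,0}` (`multiClockCorr_zero_re_nonneg`);
`chiralClockWeight_eq_multiClockWeight` identifies the matrix model of (C) as the case `J = Fin n × Fin n`.  PRIOR ART: MMP 1978 Prop. 1 /
Garban–Spencer 2022 App. Thm 21; no novelty claimed for the inequality.  Nothing here is about gauge fields yet (the `SU(3)` layer translation and a
ferromagnetic `ℤ₃` decay bound are separate, un-built steps); nothing continuum / Clay.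
-/

noncomputable section

open Finset Real

namespace Summit.Ventures.YMGap.Conjectures

variable {V J : Type*} [Fintype V] [DecidableEq V] [Fintype J]

/-! ### The multigraph clock model -/

/-- The weight of the `ℤ₃` clock model on a finite vertex type `V` driven by a finite family of pair terms `j ↦ (u_j, v_j, a_j, φ_j)`:
`w(k) = exp(∑_j a_j cos(2π·val(k_{u_j} − k_{v_j})/3 + φ_j))`. [cite: MessagerMiracleSolePfister1978, Prop. 1] -/
def multiClockWeight (u v : J → V) (a φ : J → ℝ) (k : V → ZMod 3) : ℝ :=
  Real.exp (∑ j, a j * Real.cos (2 * π * (((k (u j) - k (v j)).val : ℕ) : ℝ) / 3 + φ j))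

/-- The two-point function `⟨ω^{k_b − k_t}⟩ = (∑_k w(k) ω^{k_b−k_t}) / ∑_k w(k)` of the multigraph clock model. [cite: MessagerMiracleSolePfister1978, Prop. 1] -/
def multiClockCorr (u v : J → V) (a φ : J → ℝ) (b t : V) : ℂ :=
  (∑ k : V → ZMod 3, (multiClockWeight u v a φ k : ℂ) * omegaPow (k b - k t)) / ∑ k : V → ZMod 3, (multiClockWeight u v a φ k : ℂ)

/-- The matrix model of `Conjectures/ChiralClockComparison.lean` is the multigraph model with `J = Fin n × Fin n`, `u = fst`, `v = snd`. [folklore] -/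
theorem chiralClockWeight_eq_multiClockWeight {n : ℕ} (a φ : Fin n → Fin n → ℝ) (k : Fin n → ZMod 3) :
    chiralClockWeight a φ k = multiClockWeight (J := Fin n × Fin n) Prod.fst Prod.snd (fun j => a j.1 j.2) (fun j => φ j.1 j.2) k := by
  unfold chiralClockWeight multiClockWeight
  rw [Fintype.sum_prod_type' (f := fun x y => a x y * Real.cos (2 * π * (((k x - k y).val : ℕ) : ℝ) / 3 + φ x y))]

/-- Same for the two-point functions. [folklore] -/
theorem chiralClockCorr_eq_multiClockCorr {n : ℕ} (a φ : Fin n → Fin n → ℝ) (b t : Fin n) :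
    chiralClockCorr a φ b t = multiClockCorr (J := Fin n × Fin n) Prod.fst Prod.snd (fun j => a j.1 j.2) (fun j => φ j.1 j.2) b t := by
  unfold chiralClockCorr multiClockCorr
  simp_rw [chiralClockWeight_eq_multiClockWeight]

/-! ### The duplication identity, multigraph form -/

omit [Fintype V] [DecidableEq V] in
/-- Differences of edge spins for a general vertex type. [folklore] -/
theorem sub_apply_sub_sub_apply' (p q : V → ZMod 3) (x y : V) :
    (p - q) x - (p - q) y = (p x - p y) - (q x - q y) ∧ (p + q) x - (p + q) y = (p x - p y) + (q x - q y) := by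
  simp only [Pi.sub_apply, Pi.add_apply]
  constructor <;> ring

/-- **THE MMP DUPLICATION IDENTITY, multigraph form.**  For every real `ψ`:
`∑_{k,k'} (cos(2πk_{bt}/3) − cos(2πk'_{bt}/3 − ψ)) w_{a,0}(k) w_{a,φ}(k') = 2 ∑_{p,q} h(p) h(q) exp(∑_j 2a_j G_j(p) G_j(q))`,
`h(p) = sin(2π(p_b−p_t)/3 − ψ/2)`, `G_j(p) = cos(2π(p_{u_j}−p_{v_j})/3 + φ_j/2)` (substitution `k = p − q`, `k' = p + q`).
[cite: MessagerMiracleSolePfister1978, Prop. 1] -/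
theorem multiClock_duplication (u v : J → V) (a φ : J → ℝ) (b t : V) (ψ : ℝ) :
    ∑ k : V → ZMod 3, ∑ k' : V → ZMod 3,
      (Real.cos (2 * π * (((k b - k t).val : ℕ) : ℝ) / 3) - Real.cos (2 * π * (((k' b - k' t).val : ℕ) : ℝ) / 3 + -ψ)) *
        (multiClockWeight u v a (fun _ => 0) k * multiClockWeight u v a φ k') =
    2 * ∑ p : V → ZMod 3, ∑ q : V → ZMod 3,
      -Real.sin (2 * π * (((p b - p t).val : ℕ) : ℝ) / 3 + -ψ / 2) * -Real.sin (2 * π * (((q b - q t).val : ℕ) : ℝ) / 3 + -ψ / 2) *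
        Real.exp (∑ j, 2 * a j *
          (Real.cos (2 * π * (((p (u j) - p (v j)).val : ℕ) : ℝ) / 3 + φ j / 2) *
            Real.cos (2 * π * (((q (u j) - q (v j)).val : ℕ) : ℝ) / 3 + φ j / 2))) := by
  classical
  -- the substitution
  have key1 : ∀ u v : ZMod 3, 2 * (u - v + (u + v)) = u := by decide
  have key2 : ∀ u v : ZMod 3, 2 * (u + v - (u - v)) = v := by decide
  have key3 : ∀ u v : ZMod 3, 2 * (u + v) - 2 * (v - u) = u := by decide
  have key4 : ∀ u v : ZMod 3, 2 * (u + v) + 2 * (v - u) = v := by decide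
  let e : (V → ZMod 3) × (V → ZMod 3) ≃ (V → ZMod 3) × (V → ZMod 3) :=
    { toFun := fun pq => (pq.1 - pq.2, pq.1 + pq.2)
      invFun := fun kk => (fun x => 2 * (kk.1 x + kk.2 x), fun x => 2 * (kk.2 x - kk.1 x))
      left_inv := fun pq => by
        refine Prod.ext (funext fun x => ?_) (funext fun x => ?_)
        · simp only [Pi.sub_apply, Pi.add_apply, key1]
        · simp only [Pi.sub_apply, Pi.add_apply, key2]
      right_inv := fun kk => by
        refine Prod.ext (funext fun x => ?_) (funext fun x => ?_)
        · simp only [Pi.sub_apply, key3]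
        · simp only [Pi.add_apply, key4] }
  -- termwise identity after the substitution
  have hterm : ∀ p q : V → ZMod 3,
      (Real.cos (2 * π * ((((p - q) b - (p - q) t).val : ℕ) : ℝ) / 3) -
          Real.cos (2 * π * ((((p + q) b - (p + q) t).val : ℕ) : ℝ) / 3 + -ψ)) *
        (multiClockWeight u v a (fun _ => 0) (p - q) * multiClockWeight u v a φ (p + q)) =
      2 * (-Real.sin (2 * π * (((p b - p t).val : ℕ) : ℝ) / 3 + -ψ / 2) * -Real.sin (2 * π * (((q b - q t).val : ℕ) : ℝ) / 3 + -ψ / 2) *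
        Real.exp (∑ j, 2 * a j *
          (Real.cos (2 * π * (((p (u j) - p (v j)).val : ℕ) : ℝ) / 3 + φ j / 2) *
            Real.cos (2 * π * (((q (u j) - q (v j)).val : ℕ) : ℝ) / 3 + φ j / 2)))) := by
    intro p q
    -- observable
    have hobs : Real.cos (2 * π * ((((p - q) b - (p - q) t).val : ℕ) : ℝ) / 3) -
        Real.cos (2 * π * ((((p + q) b - (p + q) t).val : ℕ) : ℝ) / 3 + -ψ) =
        2 * (Real.sin (2 * π * (((p b - p t).val : ℕ) : ℝ) / 3 + -ψ / 2) *
          Real.sin (2 * π * (((q b - q t).val : ℕ) : ℝ) / 3 + -ψ / 2)) := by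
      rw [(sub_apply_sub_sub_apply' p q b t).1, (sub_apply_sub_sub_apply' p q b t).2]
      exact (cos_val_sub_add_cos_val_add (p b - p t) (q b - q t) (-ψ)).2
    -- weights
    have hw : multiClockWeight u v a (fun _ => 0) (p - q) * multiClockWeight u v a φ (p + q) =
        Real.exp (∑ j, 2 * a j *
          (Real.cos (2 * π * (((p (u j) - p (v j)).val : ℕ) : ℝ) / 3 + φ j / 2) *
            Real.cos (2 * π * (((q (u j) - q (v j)).val : ℕ) : ℝ) / 3 + φ j / 2))) := by
      unfold multiClockWeight
      rw [← Real.exp_add, ← Finset.sum_add_distrib]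
      congr 1
      refine Finset.sum_congr rfl fun j _ => ?_
      have hj := (cos_val_sub_add_cos_val_add (p (u j) - p (v j)) (q (u j) - q (v j)) (φ j)).1
      rw [(sub_apply_sub_sub_apply' p q (u j) (v j)).1, (sub_apply_sub_sub_apply' p q (u j) (v j)).2]
      simp only [add_zero]
      linear_combination (a j) * hj
    rw [hobs, hw]
    ring
  -- reindex the double sum through `e`
  let F : (V → ZMod 3) → (V → ZMod 3) → ℝ := fun k k' =>
    (Real.cos (2 * π * (((k b - k t).val : ℕ) : ℝ) / 3) - Real.cos (2 * π * (((k' b - k' t).val : ℕ) : ℝ) / 3 + -ψ)) *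
      (multiClockWeight u v a (fun _ => 0) k * multiClockWeight u v a φ k')
  let R : (V → ZMod 3) → (V → ZMod 3) → ℝ := fun p q =>
    -Real.sin (2 * π * (((p b - p t).val : ℕ) : ℝ) / 3 + -ψ / 2) * -Real.sin (2 * π * (((q b - q t).val : ℕ) : ℝ) / 3 + -ψ / 2) *
      Real.exp (∑ j, 2 * a j *
        (Real.cos (2 * π * (((p (u j) - p (v j)).val : ℕ) : ℝ) / 3 + φ j / 2) *
          Real.cos (2 * π * (((q (u j) - q (v j)).val : ℕ) : ℝ) / 3 + φ j / 2)))
  show ∑ k, ∑ k', F k k' = 2 * ∑ p, ∑ q, R p q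
  have L : ∑ kk : (V → ZMod 3) × (V → ZMod 3), F kk.1 kk.2 =
      ∑ pq : (V → ZMod 3) × (V → ZMod 3), F (e pq).1 (e pq).2 := (e.sum_comp (fun kk => F kk.1 kk.2)).symm
  rw [← Fintype.sum_prod_type', ← Fintype.sum_prod_type', Finset.mul_sum, L]
  exact Finset.sum_congr rfl fun pq _ => hterm pq.1 pq.2

/-! ### The comparison theorem, multigraph form -/

/-- The partition function is positive. [folklore] -/
theorem sum_multiClockWeight_pos (u v : J → V) (a φ : J → ℝ) : 0 < ∑ k : V → ZMod 3, multiClockWeight u v a φ k :=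
  Finset.sum_pos (fun k _ => by unfold multiClockWeight; exact Real.exp_pos _) Finset.univ_nonempty

/-- `Re(e^{−iψ} ⟨ω^{k_b−k_t}⟩_{a,φ}) = (∑_k w_{a,φ}(k) cos(2πk_{bt}/3 − ψ)) / Z_{a,φ}`. [folklore] -/
theorem re_exp_mul_multiClockCorr (u v : J → V) (a φ : J → ℝ) (b t : V) (ψ : ℝ) :
    (Complex.exp (-(ψ : ℂ) * Complex.I) * multiClockCorr u v a φ b t).re =
      (∑ k : V → ZMod 3, multiClockWeight u v a φ k * Real.cos (2 * π * (((k b - k t).val : ℕ) : ℝ) / 3 + -ψ)) /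
        ∑ k : V → ZMod 3, multiClockWeight u v a φ k := by
  unfold multiClockCorr
  rw [← Complex.ofReal_sum, ← mul_div_assoc, Complex.div_ofReal_re, Finset.mul_sum, Complex.re_sum]
  congr 1
  refine Finset.sum_congr rfl fun k _ => ?_
  unfold omegaPow
  have : Complex.exp (-(ψ : ℂ) * Complex.I) * ((multiClockWeight u v a φ k : ℂ) *
      Complex.exp (2 * (Real.pi : ℂ) * Complex.I * (((k b - k t).val : ℕ) : ℂ) / 3)) =
      (multiClockWeight u v a φ k : ℂ) * Complex.exp (((2 * π * (((k b - k t).val : ℕ) : ℝ) / 3 + -ψ : ℝ) : ℂ) * Complex.I) := by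
    rw [mul_left_comm, ← Complex.exp_add]
    congr 2
    push_cast
    ring
  rw [this, Complex.re_ofReal_mul, Complex.exp_ofReal_mul_I_re]

/-- **ROTATED COMPARISON, multigraph form.**  For `a ≥ 0` and every real `ψ`: `Re(e^{−iψ} ⟨ω^{k_b−k_t}⟩_{a,φ}) ≤ Re ⟨ω^{k_b−k_t}⟩_{a,0}`.
[cite: MessagerMiracleSolePfister1978, Prop. 1] -/
theorem re_exp_mul_multiClockCorr_le (u v : J → V) (a φ : J → ℝ) (ha : ∀ j, 0 ≤ a j) (b t : V) (ψ : ℝ) :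
    (Complex.exp (-(ψ : ℂ) * Complex.I) * multiClockCorr u v a φ b t).re ≤ (multiClockCorr u v a (fun _ => 0) b t).re := by
  have h0 : (multiClockCorr u v a (fun _ => 0) b t).re =
      (Complex.exp (-((0 : ℝ) : ℂ) * Complex.I) * multiClockCorr u v a (fun _ => 0) b t).re := by
    simp
  rw [h0, re_exp_mul_multiClockCorr, re_exp_mul_multiClockCorr]
  have hZ0 := sum_multiClockWeight_pos u v a (fun _ => 0)
  have hZ1 := sum_multiClockWeight_pos u v a φ
  rw [div_le_div_iff₀ hZ1 hZ0]
  have hD := multiClock_duplication u v a φ b t ψ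
  have hnonneg : 0 ≤ ∑ k : V → ZMod 3, ∑ k' : V → ZMod 3,
      (Real.cos (2 * π * (((k b - k t).val : ℕ) : ℝ) / 3) - Real.cos (2 * π * (((k' b - k' t).val : ℕ) : ℝ) / 3 + -ψ)) *
        (multiClockWeight u v a (fun _ => 0) k * multiClockWeight u v a φ k') := by
    rw [hD]
    refine mul_nonneg (by norm_num) ?_
    have := sum_mul_mul_exp_sum_nonneg (X := V → ZMod 3) (J := J)
      (fun p => -Real.sin (2 * π * (((p b - p t).val : ℕ) : ℝ) / 3 + -ψ / 2)) (fun j => 2 * a j)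
      (fun j => by have := ha j; positivity)
      (fun j p => Real.cos (2 * π * (((p (u j) - p (v j)).val : ℕ) : ℝ) / 3 + φ j / 2))
    simpa using this
  have hsplit : ∑ k : V → ZMod 3, ∑ k' : V → ZMod 3,
      (Real.cos (2 * π * (((k b - k t).val : ℕ) : ℝ) / 3) - Real.cos (2 * π * (((k' b - k' t).val : ℕ) : ℝ) / 3 + -ψ)) *
        (multiClockWeight u v a (fun _ => 0) k * multiClockWeight u v a φ k') =
      (∑ k : V → ZMod 3, multiClockWeight u v a (fun _ => 0) k * Real.cos (2 * π * (((k b - k t).val : ℕ) : ℝ) / 3 + -(0 : ℝ))) *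
          (∑ k : V → ZMod 3, multiClockWeight u v a φ k) -
        (∑ k : V → ZMod 3, multiClockWeight u v a φ k * Real.cos (2 * π * (((k b - k t).val : ℕ) : ℝ) / 3 + -ψ)) *
          (∑ k : V → ZMod 3, multiClockWeight u v a (fun _ => 0) k) := by
    have e1 : ∀ k k' : V → ZMod 3,
        (Real.cos (2 * π * (((k b - k t).val : ℕ) : ℝ) / 3) - Real.cos (2 * π * (((k' b - k' t).val : ℕ) : ℝ) / 3 + -ψ)) *
          (multiClockWeight u v a (fun _ => 0) k * multiClockWeight u v a φ k') =
        multiClockWeight u v a (fun _ => 0) k * Real.cos (2 * π * (((k b - k t).val : ℕ) : ℝ) / 3 + -(0 : ℝ)) *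
            multiClockWeight u v a φ k' -
          multiClockWeight u v a φ k' * Real.cos (2 * π * (((k' b - k' t).val : ℕ) : ℝ) / 3 + -ψ) *
            multiClockWeight u v a (fun _ => 0) k := by
      intro k k'; rw [neg_zero, add_zero]; ring
    simp_rw [e1, Finset.sum_sub_distrib]
    rw [← Finset.sum_mul_sum, Finset.sum_comm, ← Finset.sum_mul_sum]
  rw [hsplit] at hnonneg
  linarith

/-- **GRIFFITHS' FIRST INEQUALITY, multigraph form**: `0 ≤ Re ⟨ω^{k_b−k_t}⟩_{a,0}` for `a ≥ 0`. [folklore] -/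
theorem multiClockCorr_zero_re_nonneg (u v : J → V) (a : J → ℝ) (ha : ∀ j, 0 ≤ a j) (b t : V) :
    0 ≤ (multiClockCorr u v a (fun _ => 0) b t).re := by
  have h1 := re_exp_mul_multiClockCorr_le u v a (fun _ => 0) ha b t 0
  have h2 := re_exp_mul_multiClockCorr_le u v a (fun _ => 0) ha b t π
  have e : Complex.exp (-(π : ℂ) * Complex.I) = -1 := by
    rw [show -(π : ℂ) * Complex.I = -(π * Complex.I) by ring, Complex.exp_neg, Complex.exp_pi_mul_I]; norm_num
  rw [e] at h2
  simp only [neg_mul, one_mul, Complex.neg_re] at h2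
  linarith

/-- **THE CHIRAL `ℤ₃` CLOCK COMPARISON, MULTIGRAPH FORM.**  For every finite vertex type `V`, finite family of pair terms
`j ↦ (u_j, v_j, a_j ≥ 0, φ_j)` and all `b, t : V`: `‖⟨ω^{k_b−k_t}⟩_{a,φ}‖ ≤ Re ⟨ω^{k_b−k_t}⟩_{a,0}`, the right side being the ferromagnet
with the same family of moduli and all phases zero. [cite: MessagerMiracleSolePfister1978, Prop. 1] -/
theorem multiClockComparison (u v : J → V) (a φ : J → ℝ) (ha : ∀ j, 0 ≤ a j) (b t : V) :
    ‖multiClockCorr u v a φ b t‖ ≤ (multiClockCorr u v a (fun _ => 0) b t).re := by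
  set c := multiClockCorr u v a φ b t with hc
  have hrot : (Complex.exp (-(Complex.arg c : ℂ) * Complex.I) * c).re = ‖c‖ := by
    have h := Complex.norm_mul_exp_arg_mul_I c
    have : Complex.exp (-(Complex.arg c : ℂ) * Complex.I) * c = (‖c‖ : ℂ) := by
      calc Complex.exp (-(Complex.arg c : ℂ) * Complex.I) * c
          = Complex.exp (-(Complex.arg c : ℂ) * Complex.I) * ((‖c‖ : ℂ) * Complex.exp ((Complex.arg c : ℂ) * Complex.I)) := by
            rw [h]
        _ = (‖c‖ : ℂ) * Complex.exp (-(Complex.arg c : ℂ) * Complex.I + (Complex.arg c : ℂ) * Complex.I) := by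
            rw [Complex.exp_add]; ring
        _ = (‖c‖ : ℂ) := by rw [show -(Complex.arg c : ℂ) * Complex.I + (Complex.arg c : ℂ) * Complex.I = 0 by ring,
            Complex.exp_zero, mul_one]
    rw [this, Complex.ofReal_re]
  rw [← hrot]
  exact re_exp_mul_multiClockCorr_le u v a φ ha b t (Complex.arg c)

end Summit.Ventures.YMGap.Conjectures

end
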